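import Summits.RiemannHypothesis.RiemannHypothesis.Theorems.SuzukiStructureFunctionsBasic
import Summits.RiemannHypothesis.RiemannHypothesis.Theorems.SuzukiPhiFredholmWindows

/-!
# SuzukiStructureFunctionsConvolution — Lemma 3.7 and the identity (3.9) for Suzuki's extended solutions
# `φ^ε(t,·)` on a solvable window (JFA21 §3.3, §3.6; column DBR; RH-FREE)

LINE 1 — LABEL: RH-FREE (identities for ANY Suzuki pair `(ϱ, K)` on any solvable window; no `ζ`, no zeros, no
positivity); bears_on LADDER-RH B-D → B-P(P1)/(P3) (the column's de Branges object `E(t,z)` on clean windows).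
WHAT THIS IS NOT: not progress toward RH; nothing here bears on the truth of RH.

Source: M. Suzuki, J. Funct. Anal. 281 (2021) 109116 = arXiv:1606.05726 [Suzuki2021Hamiltonians], Lemma 3.7,
eqs. (3.8)–(3.9).

Contents (seat rh-dbr-eng-5 g7; continuation of `SuzukiStructureFunctionsBasic`, p484578):
* §5 exponential bookkeeping — `integrable_decay_mul_growth` ((super-exp decay) × (exp growth) ∈ L¹),
  `setIntegral_Iic_mul_suzukiPhiExt_eq` (the `(−∞,t]`-integrals live on the window `(−t,t)`),
  `integrableOn_suzukiPhiExt`, `abs_winIntegral_le`, and **Lemma 3.7** `abs_suzukiPhiExt_le`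
  (`|φ^ε(t,x)| ≤ C e^{c|x|}` with the growth rate `c` of `K`);
* §6 **(3.9) from (3.8)** `rho_conv_suzukiPhiExt_eq`:
  `∫ ϱ(x−y)φ^ε(t,y) dy + ε∫_{(−∞,t]} ϱ(−x−y)φ^ε(t,y) dy = ϱ(−x−t)` — derived WITHOUT Fourier analysis: convolve
  (3.8) with `ϱ`, Fubini, and (K2) in the time domain (`∫ϱ(x−y)K(y+w) dy = ϱ(−x−w)`,
  `integral_rho_mul_kernel_shift`). Suzuki obtains (3.9) via the transformed equation (3.10); the
  time-domain road needs only `IsSuzukiPair` ((K1)–(K3)) and solvability of the window.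
-/

noncomputable section

-- D-0017: `Summit.<S>.<S>.…` is the designed namespace of a single-problem summit.
set_option linter.dupNamespace false

open MeasureTheory Set Complex Filter Topology
open scoped ComplexConjugate

namespace Summit.RiemannHypothesis.RiemannHypothesis.Theorems.SuzukiStructureFunctions

open Literature.NumberTheory.LFunctions Literature.NumberTheory.LFunctions.SuzukiStructure
open Summit.RiemannHypothesis.RiemannHypothesis.Theorems.SuzukiPhiExistence
  (continuous_suzukiPhiExt continuous_winPotential setIntegral_Iic_kernel_mul_suzukiPhiExt_eq)

variable {ϱ K : ℝ → ℝ} {ε t : ℝ}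

/-! ## §5 Exponential bookkeeping: (decay) × (growth) is integrable; Lemma 3.7 -/

/-- RH-FREE. A continuous function with super-exponential decay times a continuous function of
exponential growth is integrable on `ℝ`. -/
theorem integrable_decay_mul_growth {g k : ℝ → ℝ} (hg : Continuous g)
    (hdec : ∀ n : ℝ, ∃ C : ℝ, ∀ x : ℝ, |g x| ≤ C * Real.exp (-(n * |x|))) (hk : Continuous k)
    {c Ck : ℝ} (hkle : ∀ x : ℝ, |k x| ≤ Ck * Real.exp (c * |x|)) :
    Integrable fun x : ℝ => g x * k x := by
  obtain ⟨C, hC⟩ := hdec (c + 1)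
  have hC0 : 0 ≤ C := by
    have := (abs_nonneg _).trans (hC 0)
    simpa using this
  refine Integrable.mono' ((Literature.Analysis.Complex.integrable_exp_neg_mul_abs one_pos).const_mul (C * Ck))
    ((hg.mul hk).aestronglyMeasurable) (Eventually.of_forall fun x => ?_)
  rw [Real.norm_eq_abs, abs_mul]
  calc |g x| * |k x| ≤ C * Real.exp (-((c + 1) * |x|)) * (Ck * Real.exp (c * |x|)) :=
        mul_le_mul (hC x) (hkle x) (abs_nonneg _) ((abs_nonneg _).trans (hC x))
    _ = C * Ck * Real.exp (-1 * |x|) := by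
        rw [show C * Real.exp (-((c + 1) * |x|)) * (Ck * Real.exp (c * |x|)) =
          C * Ck * (Real.exp (-((c + 1) * |x|)) * Real.exp (c * |x|)) by ring, ← Real.exp_add]
        congr 2
        ring

/-- RH-FREE. Exponential growth is inherited by translates: `|k(x)| ≤ C e^{c|x|}`, `c ≥ 0` ⇒
`|k(x + a)| ≤ C e^{c|a|} e^{c|x|}`. -/
theorem growth_comp_add {k : ℝ → ℝ} {c Ck : ℝ} (hc : 0 ≤ c) (hkle : ∀ x : ℝ, |k x| ≤ Ck * Real.exp (c * |x|))
    (a x : ℝ) : |k (x + a)| ≤ Ck * Real.exp (c * |a|) * Real.exp (c * |x|) := by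
  have hCk : 0 ≤ Ck := by
    have := (abs_nonneg _).trans (hkle 0)
    simpa using this
  refine (hkle (x + a)).trans ?_
  rw [mul_assoc, ← Real.exp_add]
  refine mul_le_mul_of_nonneg_left (Real.exp_le_exp.2 ?_) hCk
  have := abs_add_le x a
  nlinarith

/-- RH-FREE. For a kernel vanishing on `(−∞,0)`, `∫_{(−∞,t]} g(y) φ^ε(t,y) dy = ∫_{(−t,t)} g(y) φ^ε(t,y) dy` for
every weight `g` (`φ^ε(t,·) = 0` on `(−∞,−t)`; the version of the cell's
`setIntegral_Iic_kernel_mul_suzukiPhiExt_eq` for an arbitrary first factor). -/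
theorem setIntegral_Iic_mul_suzukiPhiExt_eq (hK3 : ∀ u : ℝ, u < 0 → K u = 0) (g : ℝ → ℝ) (ε t : ℝ) :
    ∫ y in Iic t, g y * suzukiPhiExt K ε t y = ∫ y in Ioo (-t) t, g y * suzukiPhiExt K ε t y := by
  have h1 : ∫ y in Iic t, g y * suzukiPhiExt K ε t y = ∫ y in Icc (-t) t, g y * suzukiPhiExt K ε t y := by
    refine setIntegral_eq_of_subset_of_forall_sdiff_eq_zero measurableSet_Iic Icc_subset_Iic_self ?_
    intro y hy
    have hy' : y < -t := by
      rcases hy with ⟨hy1, hy2⟩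
      by_contra hc
      exact hy2 ⟨le_of_not_gt hc, hy1⟩
    rw [suzukiPhiExt_eq_zero_of_lt_neg hK3 hy', mul_zero]
  rw [h1]
  exact (setIntegral_congr_set (Ioo_ae_eq_Icc (μ := (volume : Measure ℝ)))).symm

/-- RH-FREE. On a solvable window, `φ^ε(t,·)` is integrable on `(−t,t)` (it is in `L²((−∞,t])`). -/
theorem integrableOn_suzukiPhiExt (hsol : ∃ X : ℝ → ℝ, IsSuzukiPhiSolution K ε t X) :
    IntegrableOn (suzukiPhiExt K ε t) (Ioo (-t) t) := by
  haveI : IsFiniteMeasure (volume.restrict (Ioo (-t) t)) := by infer_instance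
  have hmem : MemLp (suzukiPhiExt K ε t) 2 (volume.restrict (Ioo (-t) t)) :=
    (isSuzukiPhiSolution_suzukiPhiExt hsol).1.mono_measure
      (Measure.restrict_mono (fun y hy ↦ (hy.2.le : y ≤ t)) le_rfl)
  exact hmem.integrable one_le_two

/-- RH-FREE. **Growth of the window integral**: with `|K| ≤ C_K e^{c|·|}`, `c ≥ 0`,
`|∫_{(−t,t)} K(x+y)φ^ε(t,y) dy| ≤ C_K e^{c|t|} (∫_{(−t,t)}|φ^ε(t,·)|) · e^{c|x|}`. -/
theorem abs_winIntegral_le {c CK : ℝ} (hc : 0 ≤ c) (hKle : ∀ x : ℝ, |K x| ≤ CK * Real.exp (c * |x|))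
    (hsol : ∃ X : ℝ → ℝ, IsSuzukiPhiSolution K ε t X) (x : ℝ) :
    |∫ y in Ioo (-t) t, K (x + y) * suzukiPhiExt K ε t y| ≤
      CK * Real.exp (c * |t|) * (∫ y in Ioo (-t) t, |suzukiPhiExt K ε t y|) * Real.exp (c * |x|) := by
  have hCk : 0 ≤ CK := by
    have := (abs_nonneg _).trans (hKle 0)
    simpa using this
  have hint := integrableOn_suzukiPhiExt hsol
  rw [show CK * Real.exp (c * |t|) * (∫ y in Ioo (-t) t, |suzukiPhiExt K ε t y|) * Real.exp (c * |x|) =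
      ∫ y in Ioo (-t) t, CK * Real.exp (c * |t|) * Real.exp (c * |x|) * |suzukiPhiExt K ε t y| by
    rw [integral_const_mul]; ring]
  rw [← Real.norm_eq_abs]
  refine norm_integral_le_of_norm_le (hint.norm.const_mul _) ?_
  refine (ae_restrict_iff' measurableSet_Ioo).2 (Eventually.of_forall fun y hy => ?_)
  rw [Real.norm_eq_abs, abs_mul]
  refine mul_le_mul_of_nonneg_right ?_ (abs_nonneg _)
  have hyt : |y| ≤ |t| := (abs_lt.2 ⟨hy.1, hy.2⟩).le.trans (le_abs_self t)
  calc |K (x + y)| ≤ CK * Real.exp (c * |y|) * Real.exp (c * |x|) := growth_comp_add hc hKle y x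
    _ ≤ CK * Real.exp (c * |t|) * Real.exp (c * |x|) := by
        gcongr

/-- RH-FREE. **Lemma 3.7 (growth of the extended solution):** on a solvable window, with `|K| ≤ C_K e^{c|·|}`
(`c ≥ 0`), there is `C` with `|φ^ε(t,x)| ≤ C e^{c|x|}` for all real `x` («`φ^±(t,x) ≪ e^{cx}` as
`x → +∞`»; from (3.7)). -/
theorem abs_suzukiPhiExt_le (hK3 : ∀ u : ℝ, u < 0 → K u = 0) {c CK : ℝ} (hc : 0 ≤ c)
    (hKle : ∀ x : ℝ, |K x| ≤ CK * Real.exp (c * |x|)) (hsol : ∃ X : ℝ → ℝ, IsSuzukiPhiSolution K ε t X) :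
    ∃ C : ℝ, ∀ x : ℝ, |suzukiPhiExt K ε t x| ≤ C * Real.exp (c * |x|) := by
  set Iφ : ℝ := ∫ y in Ioo (-t) t, |suzukiPhiExt K ε t y| with hIφ
  refine ⟨CK * Real.exp (c * |t|) + |ε| * (CK * Real.exp (c * |t|) * Iφ), fun x => ?_⟩
  rw [suzukiPhiExt_eq hsol x, setIntegral_Iic_kernel_mul_suzukiPhiExt_eq hK3 ε t x]
  have h1 := growth_comp_add hc hKle t x
  have h2 := abs_winIntegral_le hc hKle hsol x
  calc |K (x + t) - ε * ∫ y in Ioo (-t) t, K (x + y) * suzukiPhiExt K ε t y|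
      ≤ |K (x + t)| + |ε| * |∫ y in Ioo (-t) t, K (x + y) * suzukiPhiExt K ε t y| := by
        rw [← abs_mul]; exact abs_sub _ _
    _ ≤ CK * Real.exp (c * |t|) * Real.exp (c * |x|) +
          |ε| * (CK * Real.exp (c * |t|) * Iφ * Real.exp (c * |x|)) := by
        gcongr
    _ = (CK * Real.exp (c * |t|) + |ε| * (CK * Real.exp (c * |t|) * Iφ)) * Real.exp (c * |x|) := by ring

/-! ## §6 The key identity (3.9) from (3.8) — by Fubini and (K2) in the time domain

Suzuki derives (3.9) from (3.8) by taking Fourier transforms ((3.10)) and transforming back. With (K2)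
recorded as `ϱ∗K = ϱ(−·)`, (3.9) follows from (3.8) directly: convolve (3.8) with `ϱ`, swap the two
integrals (Fubini: `ϱ` decays super-exponentially, `K` grows at most exponentially, `φ^ε(t,·)` is
integrable on the window), and use `∫ ϱ(x−y)K(y+w) dy = (ϱ∗K)(x+w) = ϱ(−x−w)`. -/

/-- RH-FREE. `∫ ϱ(x−y) K(y+w) dy = ϱ(−x−w)` ((K2) translated). -/
theorem integral_rho_mul_kernel_shift (hconv : ∀ x : ℝ, ∫ y : ℝ, ϱ (x - y) * K y = ϱ (-x)) (x w : ℝ) :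
    ∫ y : ℝ, ϱ (x - y) * K (y + w) = ϱ (-x - w) := by
  have h := integral_add_right_eq_self (μ := (volume : Measure ℝ)) (fun v : ℝ => ϱ (x + w - v) * K v) w
  have e : (fun y : ℝ => ϱ (x - y) * K (y + w)) = fun y => ϱ (x + w - (y + w)) * K (y + w) := by
    funext y; ring_nf
  rw [e, h, hconv (x + w)]
  ring_nf

/-- RH-FREE. **(3.9) ⟸ (3.8):** on a solvable window, for every real `x`,
`∫ ϱ(x−y)φ^ε(t,y) dy + ε ∫_{(−∞,t]} ϱ(−x−y)φ^ε(t,y) dy = ϱ(−x−t)`. -/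
theorem rho_conv_suzukiPhiExt_eq (h : IsSuzukiPair ϱ K) (hsol : ∃ X : ℝ → ℝ, IsSuzukiPhiSolution K ε t X)
    (x : ℝ) :
    (∫ y : ℝ, ϱ (x - y) * suzukiPhiExt K ε t y) + ε * ∫ y in Iic t, ϱ (-x - y) * suzukiPhiExt K ε t y =
      ϱ (-x - t) := by
  obtain ⟨c, CK, hc, hKle⟩ := h.abs_kernel_le
  have hK3 : ∀ u : ℝ, u < 0 → K u = 0 := fun u hu => h.kernel_eq_zero u hu.le
  set φ := suzukiPhiExt K ε t with hφdef
  set S : Set ℝ := Ioo (-t) t with hS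
  have hφc : Continuous φ := continuous_suzukiPhiExt h.continuous_kernel hK3 ε t
  have hφi : IntegrableOn φ S := integrableOn_suzukiPhiExt hsol
  -- the window integral `W(y) = ∫_S K(y+w)φ(w) dw`
  set W : ℝ → ℝ := fun y => ∫ w in S, K (y + w) * φ w with hW
  have hWc : Continuous W := by
    have hmem : MemLp φ 2 (volume.restrict S) :=
      (isSuzukiPhiSolution_suzukiPhiExt hsol).1.mono_measure
        (Measure.restrict_mono (fun y hy ↦ (hy.2.le : y ≤ t)) le_rfl)
    exact continuous_winPotential h.continuous_kernel hmem
  have hWle : ∀ y : ℝ, |W y| ≤ CK * Real.exp (c * |t|) * (∫ w in S, |φ w|) * Real.exp (c * |y|) :=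
    fun y => abs_winIntegral_le hc hKle hsol y
  -- (3.8) on all of `ℝ`, with the window integral
  have h38 : ∀ y : ℝ, φ y = K (y + t) - ε * W y := by
    intro y
    rw [hφdef, suzukiPhiExt_eq hsol y, setIntegral_Iic_kernel_mul_suzukiPhiExt_eq hK3 ε t y]
  -- decay of `y ↦ ϱ(x−y)`
  have hρxc : Continuous fun y : ℝ => ϱ (x - y) := h.continuous_rho.comp (continuous_const.sub continuous_id)
  have hρxd : ∀ n : ℝ, ∃ C : ℝ, ∀ y : ℝ, |ϱ (x - y)| ≤ C * Real.exp (-(n * |y|)) := by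
    intro n
    obtain ⟨C, hC⟩ := decay_comp_sub (decay_comp_neg h.abs_rho_le) x n
    exact ⟨C, fun y => by simpa [neg_sub] using hC y⟩
  -- Step 1: split `∫ ϱ(x−y)φ(y) dy`
  have hi1 : Integrable fun y : ℝ => ϱ (x - y) * K (y + t) :=
    integrable_decay_mul_growth hρxc hρxd (h.continuous_kernel.comp (continuous_id.add continuous_const))
      (fun y => growth_comp_add hc hKle t y)
  have hi2 : Integrable fun y : ℝ => ϱ (x - y) * W y :=
    integrable_decay_mul_growth hρxc hρxd hWc hWle
  have hsplit : ∫ y : ℝ, ϱ (x - y) * φ y = ϱ (-x - t) - ε * ∫ y : ℝ, ϱ (x - y) * W y := by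
    have e : (fun y : ℝ => ϱ (x - y) * φ y) = fun y => ϱ (x - y) * K (y + t) - ε * (ϱ (x - y) * W y) := by
      funext y; rw [h38 y]; ring
    rw [e, integral_sub hi1 (hi2.const_mul ε), integral_const_mul,
      integral_rho_mul_kernel_shift h.conv_eq x t]
  -- Step 2: Fubini in `∫ ϱ(x−y) W(y) dy`
  have hswap : ∫ y : ℝ, ϱ (x - y) * W y = ∫ w in Iic t, ϱ (-x - w) * φ w := by
    -- write the inner integral over `ℝ` with an indicator
    have eW : ∀ y : ℝ, ϱ (x - y) * W y = ∫ w : ℝ, ϱ (x - y) * K (y + w) * S.indicator φ w := by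
      intro y
      rw [hW]
      simp only
      rw [← integral_const_mul, ← integral_indicator measurableSet_Ioo]
      refine integral_congr_ae (Eventually.of_forall fun w => ?_)
      simp only
      by_cases hw : w ∈ S
      · rw [indicator_of_mem hw, indicator_of_mem hw]; ring
      · rw [indicator_of_notMem hw, indicator_of_notMem hw]; ring
    simp_rw [eW]
    -- integrability on the product
    have hφind : Integrable (S.indicator φ) := hφi.integrable_indicator measurableSet_Ioo
    obtain ⟨Cρ, hCρ⟩ := hρxd (c + 1)
    have hG : Integrable fun y : ℝ => |ϱ (x - y)| * (CK * Real.exp (c * |t|) * Real.exp (c * |y|)) := by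
      have := integrable_decay_mul_growth (g := fun y => |ϱ (x - y)|) (k := fun y =>
        CK * Real.exp (c * |t|) * Real.exp (c * |y|)) (hρxc.abs) (fun n => ?_) (by fun_prop)
        (c := c) (Ck := |CK * Real.exp (c * |t|)|) (fun y => ?_)
      · exact this
      · obtain ⟨C, hC⟩ := hρxd n
        exact ⟨C, fun y => by rw [abs_abs]; exact hC y⟩
      · rw [abs_mul, abs_of_pos (Real.exp_pos _)]
    have hprod : Integrable (Function.uncurry fun y w : ℝ => ϱ (x - y) * K (y + w) * S.indicator φ w)
        ((volume : Measure ℝ).prod volume) := by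
      refine Integrable.mono' (hG.mul_prod hφind.norm) ?_ (Eventually.of_forall fun p => ?_)
      · refine ((Continuous.aestronglyMeasurable ?_).mul ?_)
        · exact (hρxc.comp continuous_fst).mul
            (h.continuous_kernel.comp (continuous_fst.add continuous_snd))
        · exact ((hφc.measurable.indicator measurableSet_Ioo).comp measurable_snd).aestronglyMeasurable
      · rcases p with ⟨y, w⟩
        simp only [Function.uncurry_apply_pair, Real.norm_eq_abs]
        by_cases hw : w ∈ S
        · rw [indicator_of_mem hw, abs_mul, abs_mul]
          refine mul_le_mul_of_nonneg_right ?_ (abs_nonneg _)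
          refine mul_le_mul_of_nonneg_left ?_ (abs_nonneg _)
          have hwt : |w| ≤ |t| := (abs_lt.2 ⟨hw.1, hw.2⟩).le.trans (le_abs_self t)
          calc |K (y + w)| ≤ CK * Real.exp (c * |w|) * Real.exp (c * |y|) := growth_comp_add hc hKle w y
            _ ≤ CK * Real.exp (c * |t|) * Real.exp (c * |y|) := by
                have hCk : 0 ≤ CK := by
                  have := (abs_nonneg _).trans (hKle 0)
                  simpa using this
                gcongr
        · rw [indicator_of_notMem hw]
          simp
    rw [integral_integral_swap hprod]
    -- evaluate the inner integrals and return to `(−∞,t]`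
    have einner : ∀ w : ℝ, ∫ y : ℝ, ϱ (x - y) * K (y + w) * S.indicator φ w = ϱ (-x - w) * S.indicator φ w := by
      intro w
      rw [integral_mul_const, integral_rho_mul_kernel_shift h.conv_eq x w]
    simp_rw [einner]
    rw [setIntegral_Iic_mul_suzukiPhiExt_eq hK3 (fun w => ϱ (-x - w)) ε t, ← integral_indicator measurableSet_Ioo]
    refine integral_congr_ae (Eventually.of_forall fun w => ?_)
    simp only
    by_cases hw : w ∈ S
    · rw [indicator_of_mem hw, indicator_of_mem hw]
    · rw [indicator_of_notMem hw, indicator_of_notMem hw, mul_zero]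
  rw [hsplit, hswap]
  ring

end Summit.RiemannHypothesis.RiemannHypothesis.Theorems.SuzukiStructureFunctions

end
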